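import Literature.Geometry.Lorentzian.KillingFieldOnNaturality
import Literature.Geometry.Lorentzian.ChartConnection
import Literature.Geometry.Lorentzian.HypersurfaceRestriction
import Literature.Geometry.Manifold.BoundarylessRechart
import HarnessLib

/-!
# Local Killing fields of an analytic metric read in an extended chart, and back

Support file (everything proved; no definitions, no named facts) for Nomizu's extension theorem
for Killing fields (`PseudoRiemannianMetric.Nomizu1960_killing_extension`,
`NomizuKillingExtension.lean`): the manifold-level repackaging of the chart analysis of
`KillingChartAnalyticExtension.lean`. For a real-analytic manifold `M` WITHOUT BOUNDARY in the
sense of `BoundarylessManifold I M` (the model `I : ModelWithCorners ℝ E H` may have corners, so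
we must work with EXTENDED charts, whose targets are then open in `E`,
`ExtRechart.isOpen_extChartAt_target`) and a `C^ω` pseudo-Riemannian
metric `g` on `TM`, we read the metric and local Killing fields in the extended chart `φ` at a point
`x₀` and come back — the ext-chart analogue, for a general model, of `MaxAtlasChartKilling.lean`
(charts of the maximal atlas of an `𝓘(ℝ, E)`-manifold):

* the inverse extended chart `Ψ = φ⁻¹ : φ.target → M` from the open submanifold `φ.target ⊆ E` is
  a real-analytic local diffeomorphism (`contMDiff_symm`, `isInvertible_mfderiv_symm`,
  `mfderiv_extChartAt_comp_mfderiv_symm`, `inverse_mfderiv_extChartAt`);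
* the transported metric `Ψ^* g` (`PseudoRiemannianMetric.comap`) is a `C^ω` metric on the
  target, so a representative `G : E → (E →L E →L ℝ)`, `G_p(a, b) = g_{Ψ p}(dΨ a, dΨ b)`, is
  real-analytic, symmetric and nondegenerate on the target (`contDiffAt_repr`, `repr_symm`,
  `repr_nondegenerate`);
* `val_leviCivita_add_eq_coord` — for a chart metric, `g(∇_a W, b) + g(a, ∇_b W)` IS the
  coordinate Killing expression `DG(W)(a,b) + G(DW a, b) + G(a, DW b)` (O'Neill 1983, Ch. 9,
  Prop. 9.25: Killing equation ⇔ `𝓛_W g = 0`, in coordinates);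
* **down**, `coordKilling_of_killingOn` — a field `C^∞` and Killing on an open `𝒪 ⊆ M`, read in
  the chart (`X = Ψ^* f`), is a `C^∞` solution of the coordinate Killing equation of `G` at the
  points over `𝒪` (Killing fields pull back under local isometries, O'Neill 1983, Ch. 9,
  Prop. 9.25 with Ch. 3, Prop. 3.59; the tree's `IsKillingFieldOn.comap_mpullback`);
* **up**, `killingOn_mpullback_extChartAt` — a `C^∞` solution `X` of the coordinate Killing
  equation on an open `V ⊆ φ.target` defines the field `φ^* X` on `M`, `C^∞` and Killing for `g`
  on `φ.source ∩ φ⁻¹ V` (Mathlib's `ContMDiffWithinAt.mpullback_vectorField_preimage`;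
  naturality `val_leviCivita_mpullback_add`); `mpullback_extChartAt_repr_apply` — down then up
  returns the field on the source.

The chart objects are written out in full (`⟨φ.target, _⟩ : Opens E`, `fun p ↦ φ.symm p`,
`PseudoRiemannianMetric.comap … g`); no definitions are introduced.

## References

* B. O'Neill, *Semi-Riemannian geometry with applications to relativity*, Academic Press 1983,
  Ch. 3, Prop. 3.13 (Christoffel symbols), Prop. 3.59 and pp. 90–91 (local isometries preserve
  the Levi-Civita connection); Ch. 9, Def. 9.22–Prop. 9.25 (Killing fields). [ONeill1983]
* K. Nomizu, Ann. of Math. (2) 72 (1960) 105–120 (the application). [Nomizu1960]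
-/

noncomputable section

open Bundle Set Function Filter TopologicalSpace VectorField
open Literature.Geometry.Manifold (ExtRechart)
open scoped Manifold ContDiff Topology

namespace Literature.Geometry.Lorentzian

namespace ExtChartKilling

variable {E : Type*} [NormedAddCommGroup E] [NormedSpace ℝ E] {H : Type*} [TopologicalSpace H]
  {I : ModelWithCorners ℝ E H} {M : Type*} [TopologicalSpace M] [ChartedSpace H M]

section Chart

variable [IsManifold I ω M] [BoundarylessManifold I M]

/-! ### The inverse extended chart as an analytic local diffeomorphism -/

omit [IsManifold I ω M] [BoundarylessManifold I M] in
/-- `Ψ p ∈ source`. [folklore] -/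
theorem symm_mem_source [IsManifold I 1 M] [BoundarylessManifold I M] (x₀ : M) (p : (⟨(extChartAt
    I x₀).target, ExtRechart.isOpen_extChartAt_target x₀⟩ : Opens E)) :
    (extChartAt I x₀).symm p ∈ (extChartAt I x₀).source :=
  (extChartAt I x₀).map_target p.2

omit [IsManifold I ω M] [BoundarylessManifold I M] in
/-- `φ (Ψ p) = p`. [folklore] -/
theorem apply_symm [IsManifold I 1 M] [BoundarylessManifold I M] (x₀ : M) (p : (⟨(extChartAt I
    x₀).target, ExtRechart.isOpen_extChartAt_target x₀⟩ : Opens E)) :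
    extChartAt I x₀ ((extChartAt I x₀).symm p) = p :=
  (extChartAt I x₀).right_inv p.2

/-- The (open) chart target is a neighbourhood of each of its points. [folklore] -/
theorem target_mem_nhds (x₀ : M) (p : (⟨(extChartAt I x₀).target,
    ExtRechart.isOpen_extChartAt_target x₀⟩ :
    Opens E)) : (extChartAt I x₀).target ∈ 𝓝 (p : E) :=
  (ExtRechart.isOpen_extChartAt_target x₀).mem_nhds p.2

/-- The inverse extended chart is real-analytic on the (open) target. [folklore] -/
theorem contMDiff_symm (x₀ : M) : ContMDiff 𝓘(ℝ, E) I ω (fun p : (⟨(extChartAt I x₀).target,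
    ExtRechart.isOpen_extChartAt_target x₀⟩ : Opens E) ↦ (extChartAt I x₀).symm (p : E)) :=
  (contMDiffOn_extChartAt_symm x₀).comp_contMDiff contMDiff_subtype_val fun p ↦ p.2

/-- The inverse extended chart is `C^{ω + 1}` (the regularity asked by `comap` of a `C^ω`
metric). [folklore] -/
theorem contMDiff_symm_omega_succ (x₀ : M) : ContMDiff 𝓘(ℝ, E) I (ω + 1) (fun p : (⟨(extChartAt I
    x₀).target, ExtRechart.isOpen_extChartAt_target x₀⟩ : Opens E) ↦ (extChartAt I x₀).symm (p :
        E)) := by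
  rw [show ((ω : ℕ∞ω) + 1) = ω by simp]
  exact contMDiff_symm x₀

/-- The inverse extended chart is `C^{∞ + 1}` (the regularity asked by `comap` of a `C^∞`
metric). [folklore] -/
theorem contMDiff_symm_infty_succ (x₀ : M) : ContMDiff 𝓘(ℝ, E) I (∞ + 1) (fun p : (⟨(extChartAt I
    x₀).target, ExtRechart.isOpen_extChartAt_target x₀⟩ : Opens E) ↦ (extChartAt I x₀).symm (p :
        E)) :=
  (contMDiff_symm x₀).of_le le_top

/-- `(extChartAt I x₀).symm` is differentiable at the points of the target. [folklore] -/
theorem mdifferentiableAt_extChartAt_symm (x₀ : M) (p : (⟨(extChartAt I x₀).target,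
    ExtRechart.isOpen_extChartAt_target x₀⟩ : Opens E)) :
    MDifferentiableAt 𝓘(ℝ, E) I (extChartAt I x₀).symm (p : E) :=
  ((contMDiffOn_extChartAt_symm (n := ω) x₀).contMDiffAt (target_mem_nhds x₀ p)).mdifferentiableAt
    (by simp)

/-- The differential of `Ψ` from the open submanifold is the differential of
`(extChartAt I x₀).symm`. [folklore] -/
theorem mfderiv_symm_eq (x₀ : M) (p : (⟨(extChartAt I x₀).target,
    ExtRechart.isOpen_extChartAt_target x₀⟩ :
    Opens E)) :
    mfderiv 𝓘(ℝ, E) I (fun p : (⟨(extChartAt I x₀).target, ExtRechart.isOpen_extChartAt_target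
        x₀⟩ : Opens
        E) ↦ (extChartAt I x₀).symm (p : E)) p = mfderiv 𝓘(ℝ, E) I (extChartAt I x₀).symm (p : E) :=
  mfderiv_comp_subtypeVal (f := (extChartAt I x₀).symm) (mdifferentiableAt_extChartAt_symm x₀ p)

/-- The differential of the inverse extended chart is invertible. [folklore] -/
theorem isInvertible_mfderiv_symm (x₀ : M) (p : (⟨(extChartAt I x₀).target,
    ExtRechart.isOpen_extChartAt_target x₀⟩ : Opens E)) :
    (mfderiv 𝓘(ℝ, E) I (fun p : (⟨(extChartAt I x₀).target, ExtRechart.isOpen_extChartAt_target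
        x₀⟩ : Opens
        E) ↦ (extChartAt I x₀).symm (p : E)) p).IsInvertible := by
  rw [mfderiv_symm_eq, ← mfderivWithin_of_mem_nhds (Filter.mem_of_superset (target_mem_nhds x₀ p)
    (extChartAt_target_subset_range x₀))]
  exact isInvertible_mfderivWithin_extChartAt_symm p.2

/-- The differential of the inverse extended chart is injective. [folklore] -/
theorem injective_mfderiv_symm (x₀ : M) :
    ∀ p : (⟨(extChartAt I x₀).target, ExtRechart.isOpen_extChartAt_target x₀⟩ : Opens E),
        Injective (mfderiv
        𝓘(ℝ, E) I (fun p : (⟨(extChartAt I x₀).target, ExtRechart.isOpen_extChartAt_target x₀⟩ :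
            Opens E) ↦
        (extChartAt I x₀).symm (p : E)) p) :=
  fun p ↦ (isInvertible_mfderiv_symm x₀ p).injective

omit [BoundarylessManifold I M] in
/-- The extended chart is analytic at the points of its source. [folklore] -/
theorem contMDiffAt_extChartAt_of_mem {x₀ y : M} (hy : y ∈ (extChartAt I x₀).source) :
    ContMDiffAt I 𝓘(ℝ, E) ω (extChartAt I x₀) y :=
  contMDiffAt_extChartAt' (by rwa [← extChartAt_source I])

/-- `dφ_{Ψ p} ∘ dΨ_p = id` (chain rule for `φ ∘ Ψ = ι`). [folklore] -/
theorem mfderiv_extChartAt_comp_mfderiv_symm (x₀ : M) (p : (⟨(extChartAt I x₀).target,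
    ExtRechart.isOpen_extChartAt_target x₀⟩ : Opens E)) :
    (mfderiv I 𝓘(ℝ, E) (extChartAt I x₀) ((extChartAt I x₀).symm p)).comp
        (mfderiv 𝓘(ℝ, E) I (fun p : (⟨(extChartAt I x₀).target,
            ExtRechart.isOpen_extChartAt_target x₀⟩ :
            Opens E) ↦ (extChartAt I x₀).symm (p : E)) p) = ContinuousLinearMap.id ℝ E := by
  have h1 : MDifferentiableAt I 𝓘(ℝ, E) (extChartAt I x₀) ((extChartAt I x₀).symm p) :=
    (contMDiffAt_extChartAt_of_mem (symm_mem_source x₀ p)).mdifferentiableAt (by simp)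
  have h2 : MDifferentiableAt 𝓘(ℝ, E) I (fun p : (⟨(extChartAt I x₀).target,
      ExtRechart.isOpen_extChartAt_target x₀⟩ : Opens E) ↦ (extChartAt I x₀).symm (p : E)) p :=
      ((contMDiff_symm x₀) p).mdifferentiableAt (by simp)
  have h := mfderiv_comp p h1 h2
  have heq : (extChartAt I x₀) ∘ (fun p : (⟨(extChartAt I x₀).target,
      ExtRechart.isOpen_extChartAt_target
      x₀⟩ : Opens E) ↦ (extChartAt I x₀).symm (p : E)) = (Subtype.val : (⟨(extChartAt I
      x₀).target, ExtRechart.isOpen_extChartAt_target x₀⟩ : Opens E) → E) :=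
    funext fun q ↦ apply_symm x₀ q
  rw [heq, mfderiv_subtypeVal] at h
  exact h.symm

/-- `(dφ_{Ψ p})⁻¹ = dΨ_p`. [folklore] -/
theorem inverse_mfderiv_extChartAt (x₀ : M) (p : (⟨(extChartAt I x₀).target,
    ExtRechart.isOpen_extChartAt_target x₀⟩ : Opens E)) :
    (mfderiv I 𝓘(ℝ, E) (extChartAt I x₀) ((extChartAt I x₀).symm p)).inverse =
      mfderiv 𝓘(ℝ, E) I (fun p : (⟨(extChartAt I x₀).target, ExtRechart.isOpen_extChartAt_target
          x₀⟩ : Opens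
          E) ↦ (extChartAt I x₀).symm (p : E)) p := by
  have hA : (mfderiv I 𝓘(ℝ, E) (extChartAt I x₀) ((extChartAt I x₀).symm p)).IsInvertible :=
    isInvertible_mfderiv_extChartAt (symm_mem_source x₀ p)
  have h := mfderiv_extChartAt_comp_mfderiv_symm x₀ p
  ext v
  have hv := congrArg (fun L : E →L[ℝ] E ↦ L v) h
  simp only [ContinuousLinearMap.id_apply] at hv
  conv_lhs => rw [← hv]
  exact hA.inverse_apply_self _

/-- Every point of the source is `Ψ p`, `p = φ y`. [folklore] -/
theorem exists_symm_eq (x₀ : M) {y : M} (hy : y ∈ (extChartAt I x₀).source) :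
    ∃ p : (⟨(extChartAt I x₀).target, ExtRechart.isOpen_extChartAt_target x₀⟩ : Opens E),
        (extChartAt I
        x₀).symm p = y :=
  ⟨⟨extChartAt I x₀ y, (extChartAt I x₀).map_source hy⟩, (extChartAt I x₀).left_inv hy⟩

end Chart

/-! ### The Killing expression of a chart metric in coordinates -/

section KillingExpr

variable [FiniteDimensional ℝ E] {U : Opens E}
  {g' : PseudoRiemannianMetric 𝓘(ℝ, E) ∞ E (TangentSpace 𝓘(ℝ, E) : U → Type _)}
  {G : E → E →L[ℝ] E →L[ℝ] ℝ} (hG : ∀ y : U, g'.val y = G y)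
include hG

omit [FiniteDimensional ℝ E] in
/-- The derivative of the (symmetric) representative is symmetric in the form slots (local copy of
`OpensChart.fderiv_repr_symm` of `KerrKillingTangency.lean`, kept private to keep the Kerr stack
out of this file's import cone). [folklore] -/
private theorem fderiv_repr_symm (x : U) (hGx : DifferentiableAt ℝ G x) (v a b : E) :
    fderiv ℝ G x v a b = fderiv ℝ G x v b a := by
  rw [← OpensChart.fderiv_apply₂ G hGx, ← OpensChart.fderiv_apply₂ G hGx]
  have heq : (fun y ↦ G y a b) =ᶠ[𝓝 (x : E)] fun y ↦ G y b a := by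
    filter_upwards [U.2.mem_nhds x.2] with y hy
    have h := g'.symm ⟨y, hy⟩ a b
    rwa [hG ⟨y, hy⟩] at h
  rw [heq.fderiv_eq]

/-- **The Killing expression in coordinates.** For a `C^∞` metric `g'` on `U : Opens E` with
representative `G` and a vector field `W` on `U` with representative `Wf` differentiable at `x`:
`g'(∇_a W, b) + g'(a, ∇_b W) = DG_x(Wf x)(a, b) + G_x(DWf_x a, b) + G_x(a, DWf_x b)` — the
coordinate form `X^λ ∂_λ g_{μν} + g_{λν} ∂_μ X^λ + g_{μλ} ∂_ν X^λ` of the Lie derivative `𝓛_W g`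
(`∇_a W = DWf a + Γ(W)a`, `OpensChart.leviCivita_apply_eq`, and `g(Γ(Z)a, b) + g(a, Γ(Z)b) = ∂_Z
    g(a, b)`
by the Koszul form of `Γ`, `OpensChart.two_mul_val_christoffel`). O'Neill 1983, Ch. 9, Prop. 9.25;
Wald 1984, (C.3.1) read with (3.1.14). [cite: ONeill1983, Ch. 9, Prop. 9.25] -/
theorem val_leviCivita_add_eq_coord [g'.HasLeviCivita] (x : U) (hGx : DifferentiableAt ℝ G x)
    {W : Π y : U, TangentSpace 𝓘(ℝ, E) y} {Wf : E → E} (hW : ∀ y : U, W y = Wf y)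
    (hWd : DifferentiableAt ℝ Wf x) (a b : E) :
    g'.val x (g'.leviCivita W x a) b + g'.val x a (g'.leviCivita W x b) =
      fderiv ℝ G x (Wf x) a b + G x (fderiv ℝ Wf x a) b + G x a (fderiv ℝ Wf x b) := by
  rw [OpensChart.leviCivita_apply_eq hG x hW hWd a, OpensChart.leviCivita_apply_eq hG x hW hWd b,
    hW x]
  have hval : ∀ P Q : E, g'.val x P Q = G x P Q := fun P Q ↦
    DFunLike.congr_fun (DFunLike.congr_fun (hG x) P) Q
  have h2 := OpensChart.two_mul_val_christoffel (g := g') (G := G) x (Wf x) a b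
  have h3 := OpensChart.two_mul_val_christoffel (g := g') (G := G) x (Wf x) b a
  rw [OpensChart.koszulForm_apply, hval] at h2 h3
  have hsym : ∀ P Q : E, G x P Q = G x Q P := fun P Q ↦ by
    have h := g'.symm x P Q
    rwa [hval, hval] at h
  have hs1 := fderiv_repr_symm hG x hGx a (Wf x) b
  have hs2 := fderiv_repr_symm hG x hGx b (Wf x) a
  have hs3 := fderiv_repr_symm hG x hGx (Wf x) b a
  have hs := hsym a (OpensChart.christoffel g' G x (Wf x) b)
  simp only [map_add, add_apply, hval]
  linear_combination (1 / 2 : ℝ) * h2 + (1 / 2 : ℝ) * h3 + hs + (1 / 2 : ℝ) * hs1 +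
    (1 / 2 : ℝ) * hs2 + (1 / 2 : ℝ) * hs3

end KillingExpr

/-! ### The metric transported to the chart target and its representative -/

section Metric

variable [FiniteDimensional ℝ E] [IsManifold I ω M] [BoundarylessManifold I M]
  (g : PseudoRiemannianMetric I ω E (TangentSpace I : M → Type _))

/-- A representative `G : E → (E →L E →L ℝ)` of `g` in the chart at `x₀`
(`G_p(a, b) = g_{Ψ p}(dΨ_p a, dΨ_p b)` on the target) represents the transported metric `Ψ^* g`.
[folklore] -/
theorem val_comap_eq_repr (x₀ : M) {G : E → E →L[ℝ] E →L[ℝ] ℝ}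
    (hG : ∀ (p : (⟨(extChartAt I x₀).target, ExtRechart.isOpen_extChartAt_target x₀⟩ : Opens E))
        (a b : E),
        G p a b = g.val ((extChartAt I x₀).symm p)
      (mfderiv 𝓘(ℝ, E) I (fun p : (⟨(extChartAt I x₀).target, ExtRechart.isOpen_extChartAt_target
          x₀⟩ :
          Opens E) ↦ (extChartAt I x₀).symm (p : E)) p a) (mfderiv 𝓘(ℝ, E) I (fun p :
          (⟨(extChartAt I x₀).target, ExtRechart.isOpen_extChartAt_target x₀⟩ : Opens E) ↦
              (extChartAt I
          x₀).symm (p : E)) p b)) (p : (⟨(extChartAt I x₀).target,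
              ExtRechart.isOpen_extChartAt_target x₀⟩ :
          Opens E)) :
    (PseudoRiemannianMetric.comap PseudoRiemannianMetric.contMDiff_pullbackBilin_holds (fun p :
        (⟨(extChartAt I x₀).target, ExtRechart.isOpen_extChartAt_target x₀⟩ : Opens E) ↦
            (extChartAt I
        x₀).symm (p : E)) (contMDiff_symm_omega_succ x₀) (injective_mfderiv_symm x₀) rfl g).val p
        = G p := by
  ext a b
  exact (hG p a b).symm

/-- Such a representative exists (extend `(Ψ^* g).val` by `0`). [folklore] -/
theorem exists_repr (x₀ : M) :
    ∃ G : E → E →L[ℝ] E →L[ℝ] ℝ, ∀ (p : (⟨(extChartAt I x₀).target,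
        ExtRechart.isOpen_extChartAt_target x₀⟩
        : Opens E)) (a b : E), G p a b =
      g.val ((extChartAt I x₀).symm p) (mfderiv 𝓘(ℝ, E) I (fun p : (⟨(extChartAt I x₀).target,
          ExtRechart.isOpen_extChartAt_target x₀⟩ : Opens E) ↦ (extChartAt I x₀).symm (p : E)) p a)
        (mfderiv 𝓘(ℝ, E) I (fun p : (⟨(extChartAt I x₀).target,
            ExtRechart.isOpen_extChartAt_target x₀⟩ :
            Opens E) ↦ (extChartAt I x₀).symm (p : E)) p b) := by
  classical
  refine ⟨fun z ↦ if hz : z ∈ (extChartAt I x₀).target then (PseudoRiemannianMetric.comap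
      PseudoRiemannianMetric.contMDiff_pullbackBilin_holds (fun p : (⟨(extChartAt I x₀).target,
      ExtRechart.isOpen_extChartAt_target x₀⟩ : Opens E) ↦ (extChartAt I x₀).symm (p : E))
      (contMDiff_symm_omega_succ x₀) (injective_mfderiv_symm x₀) rfl g).val ⟨z, hz⟩ else 0,
    fun p a b ↦ ?_⟩
  have hp : (p : E) ∈ (extChartAt I x₀).target := p.2
  simp only [hp, dif_pos]
  rfl

variable {G : E → E →L[ℝ] E →L[ℝ] ℝ} {x₀ : M}
  (hG : ∀ (p : (⟨(extChartAt I x₀).target, ExtRechart.isOpen_extChartAt_target x₀⟩ : Opens E)) (a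
      b : E), G
      p a b = g.val ((extChartAt I x₀).symm p)
    (mfderiv 𝓘(ℝ, E) I (fun p : (⟨(extChartAt I x₀).target, ExtRechart.isOpen_extChartAt_target
        x₀⟩ : Opens
        E) ↦ (extChartAt I x₀).symm (p : E)) p a) (mfderiv 𝓘(ℝ, E) I (fun p : (⟨(extChartAt I
        x₀).target, ExtRechart.isOpen_extChartAt_target x₀⟩ : Opens E) ↦ (extChartAt I x₀).symm
            (p : E)) p b))
include hG

/-- **The chart representative of an analytic metric is analytic** at the points of the target
(the transported metric `Ψ^* g` is a `C^ω` metric on the open submanifold,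
`OpensChart.contMDiffAt_bilinSection_iff`). [folklore] -/
theorem contDiffAt_repr (p : (⟨(extChartAt I x₀).target, ExtRechart.isOpen_extChartAt_target x₀⟩
    : Opens E))
    : ContDiffAt ℝ ω G p :=
  (OpensChart.contMDiffAt_bilinSection_iff p (PseudoRiemannianMetric.comap
      PseudoRiemannianMetric.contMDiff_pullbackBilin_holds (fun p : (⟨(extChartAt I x₀).target,
      ExtRechart.isOpen_extChartAt_target x₀⟩ : Opens E) ↦ (extChartAt I x₀).symm (p : E))
      (contMDiff_symm_omega_succ x₀) (injective_mfderiv_symm x₀) rfl g).val G (val_comap_eq_repr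
      g x₀ hG)).1
    ((PseudoRiemannianMetric.comap PseudoRiemannianMetric.contMDiff_pullbackBilin_holds (fun p :
        (⟨(extChartAt I x₀).target, ExtRechart.isOpen_extChartAt_target x₀⟩ : Opens E) ↦
            (extChartAt I
        x₀).symm (p : E)) (contMDiff_symm_omega_succ x₀) (injective_mfderiv_symm x₀) rfl
        g).contMDiff p)

omit [FiniteDimensional ℝ E] in
/-- The representative is symmetric on the target. [folklore] -/
theorem repr_symm (p : (⟨(extChartAt I x₀).target, ExtRechart.isOpen_extChartAt_target x₀⟩ :
    Opens E)) (a b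
    : E) : G p a b = G p b a := by
  rw [hG, hG, g.symm]

/-- The representative is nondegenerate on the target. [folklore] -/
theorem repr_nondegenerate (p : (⟨(extChartAt I x₀).target, ExtRechart.isOpen_extChartAt_target
    x₀⟩ : Opens
    E)) (a : E) (h : ∀ b, G p a b = 0) : a = 0 :=
  (PseudoRiemannianMetric.comap PseudoRiemannianMetric.contMDiff_pullbackBilin_holds (fun p :
      (⟨(extChartAt I x₀).target, ExtRechart.isOpen_extChartAt_target x₀⟩ : Opens E) ↦ (extChartAt I
      x₀).symm (p : E)) (contMDiff_symm_omega_succ x₀) (injective_mfderiv_symm x₀) rfl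
      g).nondegenerate p a fun b ↦ by rw [val_comap_eq_repr g x₀ hG p]; exact h b

/-! ### Down: a local Killing field of `g` read in the chart -/

/-- **A local Killing field read in the chart solves the coordinate Killing equation.** Let `f`
be a section of `TM`, `C^∞` on the open set `𝒪` and satisfying the Killing equation of `g` there,
and let `X : E → E` represent `Ψ^* f` on the chart target (`X p = (dΨ_p)⁻¹ f(Ψ p)`). Then at every
`p` of the target with `Ψ p ∈ 𝒪`, `X` is `C^∞` and
`DG_p(X p)(a, b) + G_p(DX_p a, b) + G_p(a, DX_p b) = 0`. (Killing fields pull back under the local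
isometry `Ψ : (target, Ψ^* g) → (M, g)`, O'Neill 1983, Ch. 9, Prop. 9.25 with Ch. 3, Prop. 3.59 —
    the
tree's `IsKillingFieldOn.comap_mpullback` — and the Killing expression of the chart metric is the
coordinate one, `val_leviCivita_add_eq_coord`.) [cite: ONeill1983, Ch. 9, Prop. 9.25] -/
theorem coordKilling_of_killingOn [g.HasLeviCivita] {f : Π x : M, TangentSpace I x} {𝒪 : Set M}
    (h𝒪 : IsOpen 𝒪)
    (hfs : ContMDiffOn I I.tangent ∞ (fun x ↦ (TotalSpace.mk' E x (f x) : TangentBundle I M)) 𝒪)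
    (hfK : ∀ x ∈ 𝒪, ∀ v w : TangentSpace I x,
      g.val x (g.leviCivita f x v) w + g.val x v (g.leviCivita f x w) = 0)
    {X : E → E} (hX : ∀ p : (⟨(extChartAt I x₀).target, ExtRechart.isOpen_extChartAt_target x₀⟩ :
        Opens E),
        X p = mpullback 𝓘(ℝ, E) I (fun p : (⟨(extChartAt I x₀).target,
            ExtRechart.isOpen_extChartAt_target
        x₀⟩ : Opens E) ↦ (extChartAt I x₀).symm (p : E)) f p)
    (p : (⟨(extChartAt I x₀).target, ExtRechart.isOpen_extChartAt_target x₀⟩ : Opens E)) (hp :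
        (extChartAt I
        x₀).symm p ∈ 𝒪) :
    ContDiffAt ℝ ∞ X p ∧ ∀ a b : E,
      fderiv ℝ G p (X p) a b + G p (fderiv ℝ X p a) b + G p a (fderiv ℝ X p b) = 0 := by
  let g₁ := g.ofLE (show (∞ : ℕ∞ω) ≤ ω from le_top)
  haveI : g₁.HasLeviCivita := ‹g.HasLeviCivita›
  let gT := g₁.comap PseudoRiemannianMetric.contMDiff_pullbackBilin_holds (fun p : (⟨(extChartAt
      I x₀).target, ExtRechart.isOpen_extChartAt_target x₀⟩ : Opens E) ↦ (extChartAt I x₀).symm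
          (p : E))
    (contMDiff_symm_infty_succ x₀) (injective_mfderiv_symm x₀) rfl
  haveI : gT.HasLeviCivita := gT.hasLeviCivita
  have hGT : ∀ q : (⟨(extChartAt I x₀).target, ExtRechart.isOpen_extChartAt_target x₀⟩ : Opens
      E), gT.val q
      = G q := fun q ↦ by
    ext a b
    exact (hG q a b).symm
  have hkill : gT.IsKillingFieldOn (mpullback 𝓘(ℝ, E) I (fun p : (⟨(extChartAt I x₀).target,
      ExtRechart.isOpen_extChartAt_target x₀⟩ : Opens E) ↦ (extChartAt I x₀).symm (p : E)) f)
          ((fun p :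
      (⟨(extChartAt I x₀).target, ExtRechart.isOpen_extChartAt_target x₀⟩ : Opens E) ↦ (extChartAt I
      x₀).symm (p : E)) ⁻¹' 𝒪) :=
    PseudoRiemannianMetric.IsKillingFieldOn.comap_mpullback g₁
      PseudoRiemannianMetric.contMDiff_pullbackBilin_holds (contMDiff_symm_infty_succ x₀)
      (injective_mfderiv_symm x₀) rfl h𝒪 ⟨hfs, hfK⟩
  have hpre : IsOpen ((fun p : (⟨(extChartAt I x₀).target, ExtRechart.isOpen_extChartAt_target
      x₀⟩ : Opens
      E) ↦ (extChartAt I x₀).symm (p : E)) ⁻¹' 𝒪) := h𝒪.preimage (contMDiff_symm x₀).continuous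
  have hsec := hkill.contMDiffAt hpre hp
  have hXc : ContDiffAt ℝ ∞ X p := by
    rw [OpensChart.contMDiffAt_section_iff,
      OpensChart.contMDiffAt_iff p _ X (fun q ↦ (hX q).symm)] at hsec
    exact hsec
  refine ⟨hXc, fun a b ↦ ?_⟩
  have hGd : DifferentiableAt ℝ G p := (contDiffAt_repr g hG p).differentiableAt (by simp)
  have h := hkill.val_leviCivita_add hp a b
  rwa [val_leviCivita_add_eq_coord hGT p hGd (W := mpullback 𝓘(ℝ, E) I (fun p : (⟨(extChartAt I
      x₀).target, ExtRechart.isOpen_extChartAt_target x₀⟩ : Opens E) ↦ (extChartAt I x₀).symm (p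
          : E)) f)
      (Wf := X)
    (fun q ↦ (hX q).symm) (hXc.differentiableAt (by simp)) a b] at h

omit hG in
omit [FiniteDimensional ℝ E] in
/-- A representative of `Ψ^* f` on `E` exists (extend by `0`). [folklore] -/
theorem exists_repr_field (f : Π x : M, TangentSpace I x) :
    ∃ X : E → E, ∀ p : (⟨(extChartAt I x₀).target, ExtRechart.isOpen_extChartAt_target x₀⟩ :
        Opens E), X p =
        mpullback 𝓘(ℝ, E) I (fun p : (⟨(extChartAt I x₀).target,
            ExtRechart.isOpen_extChartAt_target x₀⟩ :
        Opens E) ↦ (extChartAt I x₀).symm (p : E)) f p := by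
  classical
  refine ⟨fun z ↦ if hz : z ∈ (extChartAt I x₀).target then
    (mpullback 𝓘(ℝ, E) I (fun p : (⟨(extChartAt I x₀).target, ExtRechart.isOpen_extChartAt_target
        x₀⟩ :
        Opens E) ↦ (extChartAt I x₀).symm (p : E)) f ⟨z, hz⟩ : E) else 0, fun p ↦ ?_⟩
  have hp : (p : E) ∈ (extChartAt I x₀).target := p.2
  simp only [hp, dif_pos]

/-! ### Up: a coordinate Killing solution defines a local Killing field of `g` -/

omit hG in
omit [FiniteDimensional ℝ E] in
/-- **The field on `M` defined by a coordinate field `X`**: `φ^* X` (Mathlib's `mpullback` along the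
extended chart `φ`), with values `dΨ_{φ y} X(φ y)` on the source; pulled back to the chart it is `X`
again: `Ψ^*(φ^* X) = X` on the target. [folklore] -/
theorem mpullback_symm_mpullback_extChartAt (X : E → E) (p : (⟨(extChartAt I x₀).target,
    ExtRechart.isOpen_extChartAt_target x₀⟩ : Opens E)) :
    mpullback 𝓘(ℝ, E) I (fun p : (⟨(extChartAt I x₀).target, ExtRechart.isOpen_extChartAt_target
        x₀⟩ : Opens
        E) ↦ (extChartAt I x₀).symm (p : E))
        (mpullback I 𝓘(ℝ, E) (extChartAt I x₀) (fun z : E ↦ (X z : TangentSpace 𝓘(ℝ, E) z))) p =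
      X p := by
  rw [mpullback_apply, mpullback_apply, inverse_mfderiv_extChartAt x₀ p]
  have h : X (extChartAt I x₀ ((extChartAt I x₀).symm p)) = X p := by rw [apply_symm]
  rw [h]
  exact (isInvertible_mfderiv_symm x₀ p).inverse_apply_self (X p)

omit hG in
omit [FiniteDimensional ℝ E] in
/-- **Round trip**: reading a field `f` in the chart (`X = Ψ^* f`) and coming back (`φ^* X`)
returns `f` on the chart source. [folklore] -/
theorem mpullback_extChartAt_repr_apply {f : Π x : M, TangentSpace I x} {X : E → E}
    (hX : ∀ p : (⟨(extChartAt I x₀).target, ExtRechart.isOpen_extChartAt_target x₀⟩ : Opens E), X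
        p =
        mpullback 𝓘(ℝ, E) I (fun p : (⟨(extChartAt I x₀).target,
            ExtRechart.isOpen_extChartAt_target x₀⟩ :
        Opens E) ↦ (extChartAt I x₀).symm (p : E)) f p) (p : (⟨(extChartAt I x₀).target,
        ExtRechart.isOpen_extChartAt_target x₀⟩ : Opens E)) :
    mpullback I 𝓘(ℝ, E) (extChartAt I x₀) (fun z : E ↦ (X z : TangentSpace 𝓘(ℝ, E) z))
        ((extChartAt I x₀).symm p) = f ((extChartAt I x₀).symm p) := by
  rw [mpullback_apply, inverse_mfderiv_extChartAt x₀ p]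
  have h : X (extChartAt I x₀ ((extChartAt I x₀).symm p)) = X p := by rw [apply_symm]
  rw [h, hX p, mpullback_apply]
  exact (isInvertible_mfderiv_symm x₀ p).self_apply_inverse _

/-- **A coordinate Killing solution defines a local Killing field of `g`.** Let `X : E → E` be
`C^∞` on an open subset `V` of the chart target and solve the coordinate Killing equation
`DG(X)(·,·) + G(DX ·,·) + G(·, DX ·) = 0` there. Then the field `φ^* X` on `M` is `C^∞` on
`φ.source ∩ φ ⁻¹' V` (Mathlib's `ContMDiffWithinAt.mpullback_vectorField_preimage`) and satisfies
the Killing equation of `g` at every point of that set (naturality of the Levi-Civita connection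
under the local isometry `Ψ`, `val_leviCivita_mpullback_add`, O'Neill 1983, Ch. 3, Prop. 3.59, and
`Ψ^*(φ^* X) = X`, whose Killing expression for `Ψ^* g` is the coordinate one).
[cite: ONeill1983, Ch. 9, Prop. 9.25] -/
theorem killingOn_mpullback_extChartAt [g.HasLeviCivita] {X : E → E} {V : Set E}
    (hV : IsOpen V) (hXs : ContDiffOn ℝ ∞ X V)
    (hXK : ∀ z ∈ V, ∀ a b : E,
      fderiv ℝ G z (X z) a b + G z (fderiv ℝ X z a) b + G z a (fderiv ℝ X z b) = 0) :
    ContMDiffOn I I.tangent ∞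
        (fun y ↦ (TotalSpace.mk' E y (mpullback I 𝓘(ℝ, E) (extChartAt I x₀)
          (fun z : E ↦ (X z : TangentSpace 𝓘(ℝ, E) z)) y) : TangentBundle I M))
        ((extChartAt I x₀).source ∩ extChartAt I x₀ ⁻¹' V) ∧
      ∀ y ∈ (extChartAt I x₀).source ∩ extChartAt I x₀ ⁻¹' V, ∀ v w : TangentSpace I y,
        g.val y (g.leviCivita (mpullback I 𝓘(ℝ, E) (extChartAt I x₀)
            (fun z : E ↦ (X z : TangentSpace 𝓘(ℝ, E) z))) y v) w +
          g.val y v (g.leviCivita (mpullback I 𝓘(ℝ, E) (extChartAt I x₀)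
            (fun z : E ↦ (X z : TangentSpace 𝓘(ℝ, E) z))) y w) = 0 := by
  set F : Π y : M, TangentSpace I y := mpullback I 𝓘(ℝ, E) (extChartAt I x₀)
    (fun z : E ↦ (X z : TangentSpace 𝓘(ℝ, E) z)) with hF
  -- smoothness on `source ∩ φ ⁻¹' V`
  have hsmooth : ContMDiffOn I I.tangent ∞
      (fun y ↦ (TotalSpace.mk' E y (F y) : TangentBundle I M))
      ((extChartAt I x₀).source ∩ extChartAt I x₀ ⁻¹' V) := by
    rintro y ⟨hy, hyV⟩
    have hXsec : ContMDiffWithinAt 𝓘(ℝ, E) (𝓘(ℝ, E).prod 𝓘(ℝ, E)) ∞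
        (fun z : E ↦ (TotalSpace.mk' E z (X z) : TangentBundle 𝓘(ℝ, E) E)) V (extChartAt I x₀ y) :=
      contMDiffWithinAt_vectorSpace_iff_contDiffWithinAt.2 (hXs _ hyV)
    have hext : ContMDiffAt I 𝓘(ℝ, E) ω (extChartAt I x₀) y := contMDiffAt_extChartAt_of_mem hy
    have hinv : (mfderiv I 𝓘(ℝ, E) (extChartAt I x₀) y).IsInvertible :=
      isInvertible_mfderiv_extChartAt hy
    have h := ContMDiffWithinAt.mpullback_vectorField_preimage hXsec hext hinv le_top
    exact h.mono inter_subset_right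
  refine ⟨hsmooth, ?_⟩
  -- the Killing equation, by naturality
  let g₁ := g.ofLE (show (∞ : ℕ∞ω) ≤ ω from le_top)
  haveI : g₁.HasLeviCivita := ‹g.HasLeviCivita›
  let gT := g₁.comap PseudoRiemannianMetric.contMDiff_pullbackBilin_holds (fun p : (⟨(extChartAt
      I x₀).target, ExtRechart.isOpen_extChartAt_target x₀⟩ : Opens E) ↦ (extChartAt I x₀).symm
          (p : E))
    (contMDiff_symm_infty_succ x₀) (injective_mfderiv_symm x₀) rfl
  haveI : gT.HasLeviCivita := gT.hasLeviCivita
  have hGT : ∀ q : (⟨(extChartAt I x₀).target, ExtRechart.isOpen_extChartAt_target x₀⟩ : Opens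
      E), gT.val q
      = G q := fun q ↦ by
    ext a b
    exact (hG q a b).symm
  have hsecEq : mpullback 𝓘(ℝ, E) I (fun p : (⟨(extChartAt I x₀).target,
      ExtRechart.isOpen_extChartAt_target
      x₀⟩ : Opens E) ↦ (extChartAt I x₀).symm (p : E)) F = fun q : (⟨(extChartAt I x₀).target,
      ExtRechart.isOpen_extChartAt_target x₀⟩ : Opens E) ↦ (X q : TangentSpace 𝓘(ℝ, E) q) :=
    funext fun q ↦ mpullback_symm_mpullback_extChartAt X q
  have hopen : IsOpen ((extChartAt I x₀).source ∩ extChartAt I x₀ ⁻¹' V) :=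
    isOpen_extChartAt_preimage' x₀ hV
  intro y hy
  obtain ⟨p, rfl⟩ := exists_symm_eq x₀ hy.1
  have hpV : (p : E) ∈ V := by
    have h := hy.2
    rwa [mem_preimage, apply_symm] at h
  intro v w
  have hFd : MDiffAt (T% F) ((extChartAt I x₀).symm p) :=
    ((hsmooth _ hy).contMDiffAt (hopen.mem_nhds hy)).mdifferentiableAt (by simp)
  have hB := isInvertible_mfderiv_symm x₀ p
  have hGd : DifferentiableAt ℝ G p := (contDiffAt_repr g hG p).differentiableAt (by simp)
  have hXd : DifferentiableAt ℝ X p :=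
    (hXs.differentiableOn (by simp)).differentiableAt (hV.mem_nhds hpV)
  have h := g₁.val_leviCivita_mpullback_add PseudoRiemannianMetric.contMDiff_pullbackBilin_holds
    (contMDiff_symm_infty_succ x₀) (injective_mfderiv_symm x₀) rfl hFd
    ((mfderiv 𝓘(ℝ, E) I (fun p : (⟨(extChartAt I x₀).target, ExtRechart.isOpen_extChartAt_target
        x₀⟩ : Opens
        E) ↦ (extChartAt I x₀).symm (p : E)) p).inverse v) ((mfderiv 𝓘(ℝ, E) I (fun p :
        (⟨(extChartAt I x₀).target, ExtRechart.isOpen_extChartAt_target x₀⟩ : Opens E) ↦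
            (extChartAt I
        x₀).symm (p : E)) p).inverse w)
  rw [hB.self_apply_inverse, hB.self_apply_inverse] at h
  show g₁.val ((extChartAt I x₀).symm p) (g₁.leviCivita F ((extChartAt I x₀).symm p) v) w +
      g₁.val ((extChartAt I x₀).symm p) v (g₁.leviCivita F ((extChartAt I x₀).symm p) w) = 0
  rw [← h, hsecEq, val_leviCivita_add_eq_coord hGT p hGd (W := fun q : (⟨(extChartAt I
      x₀).target, ExtRechart.isOpen_extChartAt_target x₀⟩ : Opens E) ↦
    (X q : TangentSpace 𝓘(ℝ, E) q)) (Wf := X) (fun _ ↦ rfl) hXd]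
  exact hXK p hpV _ _

end Metric

end ExtChartKilling

end Literature.Geometry.Lorentzian

end
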